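import Mathlib
import Summits.Ventures.PercRepro2.SwOutCrossGenMark
import Summits.Ventures.PercRepro2.SwOutCrossGenMin

/-!
# The mark at a dropped vertex as a `FibreData`: the link order (blind cell PercRepro2, night-4
g26, 2026-08-28; proofs/NIGHT4-G26.md §3′)

`SwOutCrossGenMark` recorded, for the mark `q`, the attachment bit of `q` with the clause
«`q` in the red cluster of `h` kept false upward», which depends on the u-arm bits.  That clause
is REDUNDANT at the non-leaking points of a class: if `q ∈ C_R(l)` then `q ∈ C_R(h)` would put `h`
into the hull of `l`, which the non-leaking realisation never does.  Dropping it leaves THE LINK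
ORDER `BetterKEQ` — the landed order together with «the red ports red-linked to `q` kept upward»
and «the blue ports blue-linked to `q` kept downward» — an order on LABELS, so that the fibre
with the link label `labelKEQ G q w = (labelKE G w, RQ w, BQ w)` is a genuine `FibreData`
(**`fibKEEQ`**: the two new axioms are `RQ_psiKE` / `BQ_psiKE` and the vacuity at a lower core
point), and the landed abstract theorem applies verbatim: **`card_le_crossKEEQ`**.  Its record
**`fibKEEQMin G q`** (`ineqM_fibKEEQ`) plugs into the far layer `card_le_crossGenFarM` and the
geometry exactly as `fibKEEMin G` does.  Census (mining/night-4/g26/): the geometric type lemma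
for the link order holds with 0 violations on the same 136 random cross bases (883,922 pairs)
and `Q` is a function of the link type in every instance; the abstract Hall condition 0 failures
on every up-set in 13 cases (as the theorem guarantees).
-/

namespace Summit.Ventures.PercRepro2

namespace CrossArm

open LocRows

open scoped Classical

section MarkQ

variable {V : Type*} (G : SimpleGraph V)

/-- The link labels: the landed label, the red ports red-linked to the mark, the blue ports
blue-linked to the mark. -/
abbrev LabelKEQ (V : Type*) := LabelKE V × (V → Prop) × (V → Prop)

/-- The link label of a point. -/
noncomputable def labelKEQ (q : V) (w : FibKE V G) : LabelKEQ V :=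
  (labelKE G w, fun j => w.2.2 j = false ∧ rlinkE G w q j,
    fun j => w.2.2 j = true ∧ rlinkE G w.flip q j)

/-- **The link order on labels**: the landed order, the red ports red-linked to the mark kept,
the blue ports blue-linked to the mark of the better label already present. -/
def BetterKEQ (l' l : LabelKEQ V) : Prop :=
  BetterKE l'.1 l.1 ∧ (∀ j, l.2.1 j → l'.2.1 j) ∧ (∀ j, l'.2.2 j → l.2.2 j)

/-- The link order is reflexive. -/
lemma BetterKEQ_refl (l : LabelKEQ V) : BetterKEQ l l :=
  ⟨BetterKE_refl _, fun _ h => h, fun _ h => h⟩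

variable [Fintype V] [DecidableEq V] [DecidableRel G.Adj] [Nonempty V]

omit [Fintype V] [DecidableEq V] [DecidableRel G.Adj] in
/-- The slab injection improves the link label. -/
lemma psiKE_ok_Q (q : V) (w : FibKE V G) (hr : leakKE G w = false) (hc : coreKE w = false) :
    BetterKEQ (labelKEQ G q (psiKE G w)) (labelKEQ G q w) :=
  ⟨(psiKE_ok G w hr hc).2.2.1, fun _ hj => RQ_psiKE G q hr hj.1 hj.2,
    fun _ hj => BQ_psiKE G q hj.1 hj.2⟩

omit [Nonempty V] in
/-- A lower core point has a better link label than its flip: it has no blue port, its flip no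
red port. -/
lemma pair_labelKEQ (q : V) (w : FibKE V G) (hw : w ∈ core0KE) :
    BetterKEQ (labelKEQ G q w) (labelKEQ G q w.flip) := by
  obtain ⟨-, he⟩ := (mem_core0KE G).1 hw
  refine ⟨pair_labelKE G w hw, fun j hj => ?_, fun j hj => ?_⟩
  · exfalso
    have hj' : (!w.2.2 j) = false := hj.1
    rw [he j] at hj'
    exact Bool.noConfusion hj'
  · exfalso
    have hj' : w.2.2 j = true := hj.1
    rw [he j] at hj'
    exact Bool.noConfusion hj'

/-- **The fibre data with edge atoms and the link label** — a genuine `FibreData`. -/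
noncomputable def fibKEEQ (hG : G.Connected) (q : V) :
    FibreData (FibKE V G) (AtomKEE V G) (LabelKEQ V) where
  flip := FibKE.flip
  flip_flip := FibKE.flip_flip
  red := redKEE G
  leakR := leakKE G
  core := coreKE
  label := labelKEQ G q
  BetterL := BetterKEQ
  betterL_refl := BetterKEQ_refl
  psi := psiKE G
  core_of_noLeak := coreKE_of_noLeak G hG
  leakR_core := leakKE_core G
  leakR_flip_core := leakKE_flip_core G
  core_flip := coreKE_flip
  psi_ok := fun w hr hc => by
    obtain ⟨h1, h2, -, -⟩ := psiKE_ok G w hr hc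
    exact ⟨h1, h2, psiKE_ok_Q G q w hr hc, psiKE_red_edge G w⟩
  psi_inj := psiKE_inj G
  core0 := core0KE
  core0_core := core0KE_core G
  core_cases := coreKE_cases G
  flip_core0 := flip_core0KE G
  pair_label := pair_labelKEQ G q
  pair_red := pair_red_edge G

open scoped Classical in
/-- **THE ABSTRACT INEQUALITY FOR THE MARK AT A DROPPED VERTEX, LINK ORDER**: on every up-set of
link types the red count is at most the blue count for every up-set of atom sets — the landed
theorem on `fibKEEQ`. -/
theorem card_le_crossKEEQ (hG : G.Connected) (q : V) {ι : Type*} [Fintype ι] [DecidableEq ι]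
    [Nonempty ι] {𝒯 : Set (TypG (LabelKEQ V) ι)} (h𝒯 : IsUpG (fibKEEQ G hG q) 𝒯)
    {𝓔 : Set (Set (AtomG (AtomKEE V G) ι))} (h𝓔 : IsUpperSet 𝓔) :
    ((QG (fibKEEQ G hG q) 𝒯).filter fun x => ERG (fibKEEQ G hG q) x ∈ 𝓔).card ≤
      ((QG (fibKEEQ G hG q) 𝒯).filter fun x => EBG (fibKEEQ G hG q) x ∈ 𝓔).card :=
  card_le_crossGen h𝒯 h𝓔

end MarkQ

section Record

open Classical

variable {X : Type*} (G : SimpleGraph X)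

/-- **The link record of any cross graph with the mark at `q`**: the `KE` fields with the link
label and the link order — no connectivity. -/
noncomputable def fibKEEQMin (q : X) : FibreMin (FibKE X G) (AtomKEE X G) (LabelKEQ X) :=
  ⟨FibKE.flip, redKEE G, leakKE G, labelKEQ G q, BetterKEQ, BetterKEQ_refl⟩

variable [Fintype X] [DecidableEq X] [DecidableRel G.Adj] [Nonempty X]
  {ι : Type*} [Fintype ι] [DecidableEq ι] [Nonempty ι]

/-- The link record of a connected component has the inequality (`card_le_crossKEEQ`). -/
theorem ineqM_fibKEEQ (hG : G.Connected) (q : X) : IneqM (fibKEEQMin G q) (ι := ι) :=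
  ineqM_of_fibreData (fibKEEQ G hG q)

end Record

end CrossArm

end Summit.Ventures.PercRepro2
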